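import Summits.PneNP.PneNP.Theorems.SoloBlindStreamingFooling
import Literature.Computability.MetaComplexity.GapMINKTSearchProofs
import HarnessLib

/-!
# THEOREM F♯: `SAT` needs one-pass space `(1/8 − o(1))·N` — the proved fragment of the summit's
# streaming form reaches the entropy rate of the CNF code

THEOREM F (`SoloBlindStreamingFooling`) proved `SAT ∉ USTREAM S T` whenever
`S N · (16 ⌊log₂ N⌋ + 74) < N` eventually, from a fooling family of `2^k` unit clauses whose
information sits in the POLARITY bits (one free bit per clause of code length `8k + 34`).  Here
the information is moved into the VARIABLE INDICES: for `t < 2^k` the `t`-th unit clause is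
`y_{idx t (f t)}` with `idx t g = 2^(k+c) + t·2^c + g` (`g < 2^c`; every index has exactly
`k + c + 1` binary digits, so all code words have one length), giving `(2^c)^(2^k) = 2^(c·2^k)`
pairwise separated prefixes of code length `≈ 2^k (8k + 8c + 34)`; the test clause `¬ y_{idx t g}`
separates `f` from `f'` at any `t` with `f t ≠ f' t`.  Hence (`mul_two_pow_le_space_of_decides_SAT`)
`c · 2^k ≤ S (foolLen k c)` for every `k, c`, and choosing `c = m (k+1)`:

* `SAT_not_mem_USTREAM_of_rate` / `SAT_not_mem_STREAM_of_rate`: for every `m ≥ 1`, if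
  `(8m + 9) · S N < m · N` for all large `N` then `SAT ∉ USTREAM S T` and `SAT ∉ STREAM S T`, for
  every update time `T` — i.e. `SAT` needs one-pass space `> m N / (8m + 9)`, a rate tending to
  `1/8`, infinitely often; e.g. (`SAT_not_mem_USTREAM_linear`) `SAT ∉ USTREAM (m N / (8m+10)) T`.

READING (calibration of THEOREM E's family `PneNP ↔ ∀ k, SAT ∉ USTREAM (N^k + k) (N^k + k)`).
`1/8` is the entropy rate of the tree's CNF code (a literal with a `B`-digit index occupies
`8B + 16` bits of a clause block after the two `boolPair` doublings and carries `≤ B + 1` free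
bits), so no fooling / state-counting argument can pass space `N/8 + o(N)`: non-uniformly the
prefix classes are at most the valid code prefixes.  The information-theoretic part of the
summit's streaming form is therefore EXACTLY the linear regime below the code's entropy rate, and
it is a theorem; from space `≈ N/8` on (in particular at every level `N^k + k`, `k ≥ 1`, of the
summit family) membership of `SAT` in `USTREAM S T` is governed by the time complexity of `SAT`
alone (the state can hold the whole instance).  No intermediate regime exists.

References: fooling sets / Myhill–Nerode (J. E. Hopcroft, J. D. Ullman, 1979, §3.4; S. Arora,
B. Barak, 2009, §13.1); streaming model of D. M. McKay, C. D. Murray, R. R. Williams, STOC 2019, §2.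
-/

namespace Summit.PneNP.PneNP.Theorems.SoloBlind

open Computability
open Literature.Computability.Complexity Literature.Computability.MetaComplexity
open Literature.Computability.MetaComplexity.McKayMurrayWilliams2019
open Literature.Computability.MetaComplexity.GapMINKTDecision (length_unaryEncodeNat)

namespace SATFool2

/-- The variable index `2^(k+c) + t·2^c + g`: block `t`, value `g`; exactly `k + c + 1` binary
digits. [folklore] -/
def idx (k c : ℕ) (t : Fin (2 ^ k)) (g : Fin (2 ^ c)) : ℕ := 2 ^ (k + c) + t * 2 ^ c + g

/-- `idx` is injective in `(t, g)`. [folklore] -/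
theorem idx_inj {k c : ℕ} {t t' : Fin (2 ^ k)} {g g' : Fin (2 ^ c)}
    (h : idx k c t g = idx k c t' g') : t = t' ∧ g = g' := by
  unfold idx at h
  have h1 : (t : ℕ) * 2 ^ c + g = (t' : ℕ) * 2 ^ c + g' := by omega
  have hpos : 0 < 2 ^ c := Nat.two_pow_pos c
  have hd : ((t : ℕ) * 2 ^ c + g) / 2 ^ c = t := by
    rw [Nat.mul_comm, Nat.mul_add_div hpos, Nat.div_eq_of_lt g.isLt]; simp
  have hd' : ((t' : ℕ) * 2 ^ c + g') / 2 ^ c = t' := by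
    rw [Nat.mul_comm, Nat.mul_add_div hpos, Nat.div_eq_of_lt g'.isLt]; simp
  have ht : (t : ℕ) = t' := by rw [← hd, ← hd', h1]
  refine ⟨Fin.ext ht, Fin.ext ?_⟩
  rw [ht] at h1
  omega

/-- Bounds: `2^(k+c) ≤ idx < 2^(k+c+1)`. [folklore] -/
theorem idx_lt (k c : ℕ) (t : Fin (2 ^ k)) (g : Fin (2 ^ c)) :
    2 ^ (k + c) ≤ idx k c t g ∧ idx k c t g < 2 ^ (k + c + 1) := by
  refine ⟨by unfold idx; omega, ?_⟩
  have ht : (t : ℕ) + 1 ≤ 2 ^ k := t.isLt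
  have h1 : (t : ℕ) * 2 ^ c + 2 ^ c ≤ 2 ^ k * 2 ^ c := by
    have := Nat.mul_le_mul_right (2 ^ c) ht
    rwa [Nat.add_mul, Nat.one_mul] at this
  have h2 : 2 ^ k * 2 ^ c = 2 ^ (k + c) := (pow_add 2 k c).symm
  have hg : (g : ℕ) < 2 ^ c := g.isLt
  unfold idx
  rw [pow_succ]
  omega

/-- The `2^k` positive unit clauses `y_{idx t (f t)}`. [folklore] -/
def pre (k c : ℕ) (f : Fin (2 ^ k) → Fin (2 ^ c)) : CNF ℕ :=
  List.ofFn fun t => [(idx k c t (f t), true)]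

/-- The test clause `¬ y_{idx t g}`. [folklore] -/
def lastClause (k c : ℕ) (t : Fin (2 ^ k)) (g : Fin (2 ^ c)) : Clause ℕ := [(idx k c t g, false)]

/-- The CNF `φ f t g`: the unit clauses of `f` followed by `¬ y_{idx t g}`. [folklore] -/
def phi (k c : ℕ) (f : Fin (2 ^ k) → Fin (2 ^ c)) (t : Fin (2 ^ k)) (g : Fin (2 ^ c)) : CNF ℕ :=
  pre k c f ++ [lastClause k c t g]

/-- The assignment making exactly the variables `y_{idx t (f t)}` true. [folklore] -/
def assign (k c : ℕ) (f : Fin (2 ^ k) → Fin (2 ^ c)) : ℕ → Bool := fun x =>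
  decide (x ∈ Finset.univ.image fun t => idx k c t (f t))

/-- `φ f t g` is satisfiable iff `f t ≠ g`. [folklore] -/
theorem satisfiable_phi_iff (k c : ℕ) (f : Fin (2 ^ k) → Fin (2 ^ c)) (t : Fin (2 ^ k))
    (g : Fin (2 ^ c)) : (phi k c f t g).Satisfiable ↔ f t ≠ g := by
  constructor
  · rintro ⟨σ, hσ⟩ hfg
    rw [CNF.eval_eq_true_iff] at hσ
    have h1 : σ (idx k c t (f t)) = true := by
      have := hσ [(idx k c t (f t), true)] (by
        simp only [phi, pre, List.mem_append, List.mem_ofFn, List.mem_singleton]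
        exact Or.inl ⟨t, rfl⟩)
      simpa [Clause.eval, Literal.eval] using this
    have h2 : σ (idx k c t g) = false := by
      have := hσ (lastClause k c t g) (by simp [phi])
      simpa [lastClause, Clause.eval, Literal.eval] using this
    rw [hfg] at h1
    rw [h1] at h2
    exact Bool.noConfusion h2
  · intro hfg
    refine ⟨assign k c f, ?_⟩
    rw [CNF.eval_eq_true_iff]
    intro cl hcl
    simp only [phi, pre, List.mem_append, List.mem_ofFn, List.mem_singleton] at hcl
    rcases hcl with ⟨t', rfl⟩ | rfl
    · have : assign k c f (idx k c t' (f t')) = true := by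
        simp only [assign, decide_eq_true_eq, Finset.mem_image, Finset.mem_univ, true_and]
        exact ⟨t', rfl⟩
      simp [Clause.eval, Literal.eval, this]
    · have : assign k c f (idx k c t g) = false := by
        simp only [assign, decide_eq_false_iff_not, Finset.mem_image, Finset.mem_univ, true_and,
          not_exists]
        intro t' ht'
        obtain ⟨rfl, hg⟩ := idx_inj ht'
        exact hfg hg
      simp [lastClause, Clause.eval, Literal.eval, this]

/-! #### The code words -/

/-- The prefix word of `f`: header (number of clauses `2^k + 1` in unary) and the blocks of the
unit clauses. [folklore] -/
def U (k c : ℕ) (f : Fin (2 ^ k) → Fin (2 ^ c)) : List Bool :=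
  boolPair (unaryEncodeNat (2 ^ k + 1)) ((pre k c f).flatMap SATFool.blk)

/-- The suffix word of the test clause. [folklore] -/
def V (k c : ℕ) (t : Fin (2 ^ k)) (g : Fin (2 ^ c)) : List Bool := SATFool.blk (lastClause k c t g)

/-- The code of `φ f t g` is `U f ++ V t g`. [folklore] -/
theorem encode_phi (k c : ℕ) (f : Fin (2 ^ k) → Fin (2 ^ c)) (t : Fin (2 ^ k)) (g : Fin (2 ^ c)) :
    encodingCNF.encode (phi k c f t g) = U k c f ++ V k c t g := by
  show boolPair (unaryEncodeNat (phi k c f t g).length)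
      ((phi k c f t g).foldr (fun cl acc => boolPair (encodingClause.encode cl) acc) []) = _
  rw [SATFool.foldr_boolPair_eq_flatMap]
  have hlen : (phi k c f t g).length = 2 ^ k + 1 := by simp [phi, pre]
  rw [hlen]
  simp [phi, U, V, boolPair, List.flatMap_append, List.append_assoc]

/-- Our variable indices have `k + c + 1` binary digits. [folklore] -/
theorem length_encodeNat_idx (k c : ℕ) (t : Fin (2 ^ k)) (g : Fin (2 ^ c)) :
    (encodeNat (idx k c t g)).length = k + c + 1 := by
  rw [TM2Pass.length_encodeNat_eq_size]
  obtain ⟨h1, h2⟩ := idx_lt k c t g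
  apply le_antisymm
  · exact Nat.size_le.2 h2
  · exact Nat.lt_size.2 h1

/-- The block of a unit clause whose variable has a `B`-digit index has length `8B + 26`.
[folklore] -/
theorem length_blk_unit (x : ℕ) (b : Bool) :
    (SATFool.blk [(x, b)]).length = 8 * (encodeNat x).length + 26 := by
  have hlit : (encodingLiteral.encode (x, b)).length = 2 * (encodeNat x).length + 3 := by
    show (boolPair (encodeNat x) (encodeBool b)).length = _
    rw [length_boolPair]
    simp [encodeBool]
  have hcl : (encodingClause.encode [(x, b)]).length = 4 * (encodeNat x).length + 12 := by
    show (boolPair (unaryEncodeNat 1) ([(x, b)].foldr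
      (fun l acc => boolPair (encodingLiteral.encode l) acc) [])).length = _
    simp only [List.foldr_cons, List.foldr_nil, length_boolPair, length_unaryEncodeNat, hlit,
      List.length_nil]
    omega
  simp only [SATFool.blk, List.length_append, List.length_flatMap, List.map_const',
    List.sum_replicate, smul_eq_mul, hcl, List.length_cons, List.length_nil]
  omega

/-- The block length of our unit clauses: `8k + 8c + 34`. [folklore] -/
theorem length_blk_idx (k c : ℕ) (t : Fin (2 ^ k)) (g : Fin (2 ^ c)) (b : Bool) :
    (SATFool.blk [(idx k c t g, b)]).length = 8 * k + 8 * c + 34 := by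
  rw [length_blk_unit, length_encodeNat_idx]; ring

/-- Total length of the blocks of the unit clauses. [folklore] -/
theorem length_flatMap_blk_pre (k c : ℕ) (f : Fin (2 ^ k) → Fin (2 ^ c)) :
    ((pre k c f).flatMap SATFool.blk).length = 2 ^ k * (8 * k + 8 * c + 34) := by
  rw [List.length_flatMap]
  have : (pre k c f).map (fun cl => (SATFool.blk cl).length) =
      (pre k c f).map fun _ => 8 * k + 8 * c + 34 := by
    apply List.map_congr_left
    intro cl hcl
    simp only [pre, List.mem_ofFn] at hcl
    obtain ⟨t, rfl⟩ := hcl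
    exact length_blk_idx k c t (f t) true
  rw [this, List.map_const', List.sum_replicate, smul_eq_mul]
  simp [pre]

/-- The common length of the words `U f ++ V t g`. [folklore] -/
def foolLen (k c : ℕ) : ℕ :=
  2 * (2 ^ k + 1) + 2 + 2 ^ k * (8 * k + 8 * c + 34) + (8 * k + 8 * c + 34)

/-- Length of the prefix word. [folklore] -/
theorem length_U (k c : ℕ) (f : Fin (2 ^ k) → Fin (2 ^ c)) :
    (U k c f).length = 2 * (2 ^ k + 1) + 2 + 2 ^ k * (8 * k + 8 * c + 34) := by
  rw [U, length_boolPair, length_unaryEncodeNat, length_flatMap_blk_pre]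

/-- Length of the suffix word. [folklore] -/
theorem length_V (k c : ℕ) (t : Fin (2 ^ k)) (g : Fin (2 ^ c)) :
    (V k c t g).length = 8 * k + 8 * c + 34 :=
  length_blk_idx k c t g false

/-- All fooling words have length `foolLen k c`. [folklore] -/
theorem length_U_append_V (k c : ℕ) (f : Fin (2 ^ k) → Fin (2 ^ c)) (t : Fin (2 ^ k))
    (g : Fin (2 ^ c)) : (U k c f ++ V k c t g).length = foolLen k c := by
  rw [List.length_append, length_U, length_V, foolLen]

/-- `2^k ≤ foolLen k c`. [folklore] -/
theorem two_pow_le_foolLen (k c : ℕ) : 2 ^ k ≤ foolLen k c := by unfold foolLen; omega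

/-- Membership of the fooling words in `SAT`. [folklore] -/
theorem U_append_V_mem_SAT_iff (k c : ℕ) (f : Fin (2 ^ k) → Fin (2 ^ c)) (t : Fin (2 ^ k))
    (g : Fin (2 ^ c)) : U k c f ++ V k c t g ∈ SAT ↔ f t ≠ g := by
  rw [← encode_phi, mem_SAT_iff, satisfiable_phi_iff]

/-- The prefixes `U f` are pairwise separated at length `foolLen k c`. [folklore] -/
theorem separated (k c : ℕ) (f f' : Fin (2 ^ k) → Fin (2 ^ c)) (h : f ≠ f') :
    ∃ v : List Bool, (U k c f ++ v).length = foolLen k c ∧ (U k c f' ++ v).length = foolLen k c ∧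
      ¬ (U k c f ++ v ∈ SAT ↔ U k c f' ++ v ∈ SAT) := by
  obtain ⟨t, ht⟩ := Function.ne_iff.1 h
  refine ⟨V k c t (f t), length_U_append_V k c f t (f t), length_U_append_V k c f' t (f t), ?_⟩
  rw [U_append_V_mem_SAT_iff, U_append_V_mem_SAT_iff]
  have h2 : f' t ≠ f t := fun h => ht h.symm
  simp [h2]

end SATFool2

/-! ### THEOREM F♯: the linear space lower bound for `SAT` -/

open SATFool2

/-- **Space lower bound at the fooling lengths.** Any one-pass streaming algorithm deciding `SAT`
in space `S` on runs has `c · 2^k ≤ S (foolLen k c)` for all `k, c`. [folklore (fooling set)] -/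
theorem mul_two_pow_le_space_of_decides_SAT {A : StreamingAlgorithm} {S : ℕ → ℕ}
    (hS : RunsInSpace A S) (hD : A.Decides SAT) (k c : ℕ) : c * 2 ^ k ≤ S (foolLen k c) := by
  have h := card_lt_two_pow_of_fooling hS hD (N := foolLen k c) (U k c)
    (fun f => by
      have := length_U_append_V k c f ⟨0, Nat.two_pow_pos k⟩ ⟨0, Nat.two_pow_pos c⟩
      rw [List.length_append] at this; omega)
    (fun f f' h => separated k c f f' h)
  simp only [Fintype.card_fun, Fintype.card_fin] at h
  rw [← pow_mul] at h
  have := (Nat.pow_lt_pow_iff_right (by norm_num : 1 < 2)).1 h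
  omega

/-- `SAT ∈ USTREAM S T → c · 2^k ≤ S (foolLen k c)` (any `T`). [folklore (fooling set)] -/
theorem mul_two_pow_le_space_of_SAT_mem_USTREAM {S T : ℕ → ℕ} (hmem : SAT ∈ USTREAM S T)
    (k c : ℕ) : c * 2 ^ k ≤ S (foolLen k c) := by
  obtain ⟨A, -, hS, -, -, hD⟩ := hmem
  exact mul_two_pow_le_space_of_decides_SAT hS hD k c

/-- `SAT ∈ STREAM S T → c · 2^k ≤ S (foolLen k c)` (non-uniform class). [folklore] -/
theorem mul_two_pow_le_space_of_SAT_mem_STREAM {S T : ℕ → ℕ} (hmem : SAT ∈ STREAM S T)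
    (k c : ℕ) : c * 2 ^ k ≤ S (foolLen k c) := by
  obtain ⟨A, hS, -, hD⟩ := hmem
  exact mul_two_pow_le_space_of_decides_SAT (runsInSpace_of_hasSpace hS) hD k c

/-- Elementary growth bound used to place a fooling length: `8 (k+1)² + 30 ≤ 2^k` for `k ≥ 10`.
[folklore] -/
theorem eight_sq_le_two_pow {k : ℕ} (hk : 10 ≤ k) : 8 * (k + 1) ^ 2 + 30 ≤ 2 ^ k := by
  induction k, hk using Nat.le_induction with
  | base => norm_num
  | succ k hk ih =>
    have h1 : 8 * (k + 1 + 1) ^ 2 + 30 ≤ 2 * (8 * (k + 1) ^ 2 + 30) := by nlinarith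
    have h2 : 2 ^ (k + 1) = 2 * 2 ^ k := by ring
    omega

/-- The asymptotic form: a space bound with `(8m+9) · S N < m · N` for all large `N` (`m ≥ 1`) is
violated at the fooling length `foolLen k (m (k+1))` for a suitable `k`. [folklore] -/
theorem exists_foolLen_violation_rate {S : ℕ → ℕ} {m : ℕ} (hm : 1 ≤ m)
    (h : ∃ N₀, ∀ N ≥ N₀, (8 * m + 9) * S N < m * N) :
    ∃ k c, S (foolLen k c) < c * 2 ^ k := by
  obtain ⟨N₀, hN₀⟩ := h
  set k := N₀ + m + 28 with hk
  refine ⟨k, m * (k + 1), ?_⟩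
  have hkN : N₀ ≤ foolLen k (m * (k + 1)) :=
    le_trans (le_trans (by omega) Nat.lt_two_pow_self.le) (two_pow_le_foolLen k _)
  have hN := hN₀ _ hkN
  by_contra hcon
  rw [not_lt] at hcon
  -- `P = 2^k` is large: `2^k ≥ 8 (k+1)^2 + 30 ≥ 8 (m+1)(k+1) + 30`
  have hP : 8 * (k + 1) ^ 2 + 30 ≤ 2 ^ k := eight_sq_le_two_pow (by omega)
  have hmk : m + 1 ≤ k + 1 := by omega
  set P := 2 ^ k with hPdef
  have hP' : 8 * ((m + 1) * (k + 1)) + 30 ≤ P := by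
    have : (m + 1) * (k + 1) ≤ (k + 1) ^ 2 := by nlinarith
    omega
  -- the closed form of the fooling length with `c = m (k+1)`
  have hL : foolLen k (m * (k + 1)) = 2 * (P + 1) + 2 + P * (8 * ((m + 1) * (k + 1)) + 26) +
      (8 * ((m + 1) * (k + 1)) + 26) := by
    simp only [foolLen, hPdef]; ring
  -- from `m (k+1) P ≤ S` and `(8m+9) S < m L` derive a contradiction
  have h1 : (8 * m + 9) * (m * (k + 1) * P) ≤ (8 * m + 9) * S (foolLen k (m * (k + 1))) :=
    Nat.mul_le_mul_left _ hcon
  have h2 : (8 * m + 9) * (m * (k + 1) * P) < m * foolLen k (m * (k + 1)) := lt_of_le_of_lt h1 hN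
  rw [hL] at h2
  -- divide the picture by `m`: show `m * L ≤ (8m+9) * (m (k+1) P)`
  have h3 : 2 * (P + 1) + 2 + P * (8 * ((m + 1) * (k + 1)) + 26) + (8 * ((m + 1) * (k + 1)) + 26)
      ≤ (8 * m + 9) * ((k + 1) * P) := by
    have hk28 : 29 ≤ k + 1 := by omega
    have e1 : (8 * m + 9) * ((k + 1) * P) = P * (8 * ((m + 1) * (k + 1))) + (k + 1) * P := by ring
    rw [e1]
    have : 29 * P ≤ (k + 1) * P := Nat.mul_le_mul_right P hk28
    nlinarith
  have h4 : m * (2 * (P + 1) + 2 + P * (8 * ((m + 1) * (k + 1)) + 26) +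
      (8 * ((m + 1) * (k + 1)) + 26)) ≤ (8 * m + 9) * (m * (k + 1) * P) := by
    have := Nat.mul_le_mul_left m h3
    calc _ ≤ m * ((8 * m + 9) * ((k + 1) * P)) := this
      _ = (8 * m + 9) * (m * (k + 1) * P) := by ring
  omega

/-- **THEOREM F♯, headline (uniform).** For every `m ≥ 1`: if `(8m+9) · S N < m · N` for all
large `N`, then `SAT ∉ USTREAM S T` for every `T` — one-pass algorithms for `SAT` need space
`> m N/(8m+9)`, a rate tending to the code's entropy rate `1/8`, whatever their update time.
[folklore (fooling set)] -/
theorem SAT_not_mem_USTREAM_of_rate {S : ℕ → ℕ} {m : ℕ} (hm : 1 ≤ m)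
    (h : ∃ N₀, ∀ N ≥ N₀, (8 * m + 9) * S N < m * N) (T : ℕ → ℕ) :
    SAT ∉ USTREAM S T := fun hmem => by
  obtain ⟨k, c, hk⟩ := exists_foolLen_violation_rate hm h
  exact Nat.lt_irrefl _ (Nat.lt_of_le_of_lt (mul_two_pow_le_space_of_SAT_mem_USTREAM hmem k c) hk)

/-- **THEOREM F♯, headline (non-uniform).** The same for the non-uniform class `STREAM S T`.
[folklore (fooling set)] -/
theorem SAT_not_mem_STREAM_of_rate {S : ℕ → ℕ} {m : ℕ} (hm : 1 ≤ m)
    (h : ∃ N₀, ∀ N ≥ N₀, (8 * m + 9) * S N < m * N) (T : ℕ → ℕ) :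
    SAT ∉ STREAM S T := fun hmem => by
  obtain ⟨k, c, hk⟩ := exists_foolLen_violation_rate hm h
  exact Nat.lt_irrefl _ (Nat.lt_of_le_of_lt (mul_two_pow_le_space_of_SAT_mem_STREAM hmem k c) hk)

/-- **Linear space is necessary**: `SAT ∉ USTREAM (m N / (8m+10)) T` for every `m ≥ 1` and every
`T` (space rate `m/(8m+10) ↗ 1/8`). [folklore (fooling set)] -/
theorem SAT_not_mem_USTREAM_linear {m : ℕ} (hm : 1 ≤ m) (T : ℕ → ℕ) :
    SAT ∉ USTREAM (fun N => m * N / (8 * m + 10)) T := by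
  refine SAT_not_mem_USTREAM_of_rate hm ⟨1, fun N hN => ?_⟩ T
  have hq : (8 * m + 10) * (m * N / (8 * m + 10)) ≤ m * N := Nat.mul_div_le _ _
  have hmN : 1 ≤ m * N := Nat.one_le_iff_ne_zero.2 (Nat.mul_ne_zero (by omega) (by omega))
  have he : (8 * m + 10) * (m * N / (8 * m + 10)) =
      (8 * m + 9) * (m * N / (8 * m + 10)) + m * N / (8 * m + 10) := by ring
  rcases Nat.eq_zero_or_pos (m * N / (8 * m + 10)) with h0 | hpos
  · rw [h0]; omega
  · omega

/-- The non-uniform form of the previous statement. [folklore (fooling set)] -/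
theorem SAT_not_mem_STREAM_linear {m : ℕ} (hm : 1 ≤ m) (T : ℕ → ℕ) :
    SAT ∉ STREAM (fun N => m * N / (8 * m + 10)) T := by
  refine SAT_not_mem_STREAM_of_rate hm ⟨1, fun N hN => ?_⟩ T
  have hq : (8 * m + 10) * (m * N / (8 * m + 10)) ≤ m * N := Nat.mul_div_le _ _
  have hmN : 1 ≤ m * N := Nat.one_le_iff_ne_zero.2 (Nat.mul_ne_zero (by omega) (by omega))
  have he : (8 * m + 10) * (m * N / (8 * m + 10)) =
      (8 * m + 9) * (m * N / (8 * m + 10)) + m * N / (8 * m + 10) := by ring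
  rcases Nat.eq_zero_or_pos (m * N / (8 * m + 10)) with h0 | hpos
  · rw [h0]; omega
  · omega

/-- In particular `SAT ∉ USTREAM (N / 18) T`: one-pass algorithms for `SAT` need linear space.
[folklore (fooling set)] -/
theorem SAT_not_mem_USTREAM_div18 (T : ℕ → ℕ) : SAT ∉ USTREAM (fun N => N / 18) T := by
  have := SAT_not_mem_USTREAM_linear (m := 1) le_rfl T
  simpa using this

end Summit.PneNP.PneNP.Theorems.SoloBlind
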